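import Summits.QuantumFields.BalabanUV.Beta.GradientMemberBox
import Summits.QuantumFields.BalabanUV.Beta.GreenNewtonBoundD4

/-!
# Beta / FlatGradientBinderD4 — THE OWNER's FLAT POISSON INTERIOR GRADIENT BINDER (FG) OF FILE 19b `MultiscaleGradientMember`, DISCHARGED
# IN d = 4 WITH NO HYPOTHESIS: GR3 `GradientMemberBox.fdiff_le_box` + road P3's pointwise Green bound `GreenNewtonBoundD4.green_le_inv_dist_pow`
# (chain «LATTICE-GRADIENT-MEMBER», adapter; O.2 item (i), the gradient member (3.42)₂ at MODEL level — flat transport, Bałaban's dimension)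

WHAT IS CERTIFIED (kernel, 0 sorry).  **`flatGradient_binder_d4`** — for every torus `N : Fin 4 → ℕ` and constant bond weight `c ≡ c₀ ≠ 0`, the
binder (FG) of `MultiscaleGradientMember.real_grad_levelOp_inverse_le_of_flatGradient` IN ITS OWN LETTERS:
`∀ x₀ R, 1 ≤ R → (∀ i, 10R+4 ≤ N i) → ∀ w M G, (|w| ≤ M on dist(·,x₀) ≤ 2R+2) → (|W·w − Nw| ≤ G there) →
 ∀ μ, |w(x₀+e_μ) − w(x₀)| ≤ K₁·M∕(R+1) + K₂·(R+1)·G∕c₀²` with **`K₁ = Kgrad 4`, `K₂ = 9∕2·Kgrad 4 + 36·Cdip 4·Cps 4`** (`d`-only numbers;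
`Kgrad_four_ge`: `K₁ ≥ 6`).  Proof: if `8R + 10 ≤ N_μ` for all `μ`, GR3 on the ball `B = {dist(·,x₀) ≤ 2R+2}` with the pointwise Green bound
`green_c B z y ≤ (3∕c₀²)((dist z y + 1)^{4−2})⁻¹` of road P3 (`4D + 2 ≤ N_μ`, `D = 2R+2`); otherwise `10R + 4 ≤ N_μ < 8R + 10` forces `R ≤ 2`
and the trivial bound `2M ≤ K₁·M∕(R+1)` applies.  So the owner's file 19b holds HYPOTHESIS-FREE in d = 4 for the flat MODEL.
(unit `b2b-balaban-beta-d4-p2`, GEN 11, MODEL crew; claim «LATTICE-GRADIENT-MEMBER» journal l.23681; (FG) spec: an4-g46 l.24369; road P3 =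
`b2b-balaban-beta-d4-p3`, «GREEN-NEWTON-BOUND-D4» l.24407∕p243850.)

HONEST FRAMING: discharging `BetaPertH` makes Bałaban's UV stability UNCONDITIONAL — NOT the continuum limit, NOT the Clay problem.
HONEST DEPENDENCY (verbatim): «continuum YM on T⁴ ⇐ BetaPertH ∧ nine spine estimates (0/9 proved); BetaPertH ⇐ (D1) ∧ (D4) ∧ CAP+tail;
G-an2-4 gates asym, D1 and NE2/3/4.»  THIS MODULE DISCHARGES NOTHING of `BetaPertH`, asserts NOTHING printed and cites nothing as a fact
(ABSOLUTE RULE): [folklore] discrete potential theory of the FREE torus Laplacian (constant weight, U = 1, d = 4); nothing of Bałaban's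
∇_UG′(U); print's (3.42)₂ is [B4] Lemma 2.2 — NOT reproduced.  LOCATORS (shape only): [Balaban1985BackgroundPropagators] Thm 3.1 (3.42)
p. 397.  No class change on row D4 (critical-path width 0; D4 DISCHARGE NO DATE); NOT BetaPertH, NOT continuum, NOT Clay, NOT summit progress.
-/

open scoped BigOperators
open Finset

namespace Summit.QuantumFields.BalabanUV.Beta.FlatGradientBinderD4

open Literature.MathematicalPhysics.QuantumFieldTheory.Balaban1983to89
open Literature.MathematicalPhysics.QuantumFieldTheory.Balaban1983to89.B9Thm37GluePU (bsrc btgt)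
open B5TorusCover (UT)
open B5Leibniz121 (up dist_up_le)
open Summit.QuantumFields.BalabanUV.Beta.HarmonicGradientInterior (Kgrad)
open Summit.QuantumFields.BalabanUV.Beta.TorusInversePowerSums (Cps Cps_nonneg)
open Summit.QuantumFields.BalabanUV.Beta.GreenGradientRowSum (Cdip Cdip_nonneg Kgrad_nonneg)
open Summit.QuantumFields.BalabanUV.Beta.SubsolutionMeanValueBox (Cmv one_le_Cmv)
open Summit.QuantumFields.BalabanUV.Beta.GraphGreenFunction (green)
open Summit.QuantumFields.BalabanUV.Beta.GradientMemberBox (fdiff_le_box)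
open Summit.QuantumFields.BalabanUV.Beta.GreenNewtonBoundD4 (green_le_inv_dist_pow)

noncomputable section

/-- `Kgrad 4 ≥ 6` (`Cmv 4 ≥ 1`, `√208 ≥ 14`, `3⁴ = 81`). [folklore] -/
theorem Kgrad_four_ge : (6 : ℝ) ≤ Kgrad 4 := by
  unfold Kgrad
  have h1 : (1 : ℝ) ≤ Cmv 4 := one_le_Cmv (by norm_num)
  have h2 : (14 : ℝ) ≤ Real.sqrt (52 * (4 : ℕ)) := by
    rw [show (52 : ℝ) * (4 : ℕ) = 208 by norm_num]
    exact Real.le_sqrt_of_sq_le (by norm_num)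
  have h3 : ((3 : ℝ)) ^ 4 = 81 := by norm_num
  rw [h3]
  nlinarith

variable {N : Fin 4 → ℕ} [∀ i, NeZero (N i)]

/-- **THE FLAT POISSON INTERIOR GRADIENT BINDER (FG) OF FILE 19b, d = 4, NO HYPOTHESIS** — in the owner's letters, with `K₁ = Kgrad 4`,
`K₂ = 9/2·Kgrad 4 + 36·Cdip 4·Cps 4`. [cite: Balaban1985BackgroundPropagators, Thm 3.1 (3.42) p.397] [folklore] -/
theorem flatGradient_binder_d4 {c : UT N × Fin 4 → ℝ} {c₀ : ℝ} (hc : ∀ b, c b = c₀) (hc₀ : c₀ ≠ 0) :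
    ∀ (x₀ : UT N) (R : ℕ), 1 ≤ R → (∀ i, 10 * R + 4 ≤ N i) → ∀ (w : UT N → ℝ) (M G : ℝ),
      (∀ x ∈ univ.filter (fun x : UT N => dist x x₀ ≤ 2 * R + 2), |w x| ≤ M) →
      (∀ x ∈ univ.filter (fun x : UT N => dist x x₀ ≤ 2 * R + 2),
        |((∑ b ∈ univ.filter (fun b : UT N × Fin 4 => btgt b = x), c b ^ 2) +
              ∑ b ∈ univ.filter (fun b : UT N × Fin 4 => bsrc b = x), c b ^ 2) * w x -
            ((∑ b ∈ univ.filter (fun b : UT N × Fin 4 => btgt b = x), c b ^ 2 * w (bsrc b)) +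
              ∑ b ∈ univ.filter (fun b : UT N × Fin 4 => bsrc b = x), c b ^ 2 * w (btgt b))| ≤ G) →
      ∀ μ, |w (up x₀ μ) - w x₀| ≤
        Kgrad 4 * M / ((R : ℝ) + 1) + (9 / 2 * Kgrad 4 + 36 * Cdip 4 * Cps 4) * ((R : ℝ) + 1) * G / c₀ ^ 2 := by
  intro x₀ R hR hN w M G hM hGsrc μ
  have hc2 : (0 : ℝ) < c₀ ^ 2 := by positivity
  have hR0 : (0 : ℝ) < (R : ℝ) + 1 := by positivity
  have hKg : 0 ≤ Kgrad 4 := Kgrad_nonneg (by norm_num)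
  have hC1 : 0 ≤ Cdip 4 := Cdip_nonneg (by norm_num)
  have hCp : 0 ≤ Cps 4 := Cps_nonneg 4
  -- `M ≥ 0` and `G ≥ 0` (read at the centre)
  have hx₀ : x₀ ∈ univ.filter (fun x : UT N => dist x x₀ ≤ 2 * R + 2) :=
    Finset.mem_filter.mpr ⟨Finset.mem_univ _, by rw [dist_self]; positivity⟩
  have hM0 : 0 ≤ M := (abs_nonneg _).trans (hM x₀ hx₀)
  have hG0 : 0 ≤ G := (abs_nonneg _).trans (hGsrc x₀ hx₀)
  have hsecond : 0 ≤ (9 / 2 * Kgrad 4 + 36 * Cdip 4 * Cps 4) * ((R : ℝ) + 1) * G / c₀ ^ 2 := by positivity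
  by_cases hroom : ∀ μ' : Fin 4, 4 * (2 * R + 2) + 2 ≤ N μ'
  · -- GR3 with road P3's pointwise Green bound on the ball of radius `2R+2`
    have ecast : ((2 * R + 2 : ℕ) : ℝ) = 2 * (R : ℝ) + 2 := by push_cast; ring
    have hBD : ∀ x ∈ univ.filter (fun x : UT N => dist x x₀ ≤ 2 * R + 2), dist x x₀ ≤ ((2 * R + 2 : ℕ) : ℝ) :=
      fun x hx => by rw [ecast]; exact (Finset.mem_filter.mp hx).2
    have hG : ∀ x' y : UT N, green bsrc btgt c (univ.filter (fun y : UT N => dist y x₀ ≤ 2 * R + 2)) x' y ≤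
        3 / c₀ ^ 2 * ((dist x' y + 1) ^ (4 - 2))⁻¹ :=
      fun x' y => green_le_inv_dist_pow hc hc₀ _ x₀ hBD hroom x' y
    have h := fdiff_le_box hc hc₀ x₀ hR hN (by positivity : (0 : ℝ) ≤ 3 / c₀ ^ 2) hG w hG0 hM hGsrc μ
    have e : Kgrad 4 * M / ((R : ℝ) + 1) + (9 / 2 * Kgrad 4 / c₀ ^ 2 + 12 * Cdip 4 * Cps 4 * (3 / c₀ ^ 2)) * ((R : ℝ) + 1) * G =
        Kgrad 4 * M / ((R : ℝ) + 1) + (9 / 2 * Kgrad 4 + 36 * Cdip 4 * Cps 4) * ((R : ℝ) + 1) * G / c₀ ^ 2 := by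
      field_simp
      ring
    rw [e] at h
    exact h
  · -- small `R`: the trivial bound
    push Not at hroom
    obtain ⟨μ', hμ'⟩ := hroom
    have hR2 : R ≤ 2 := by have := hN μ'; omega
    have hR3 : (R : ℝ) + 1 ≤ 3 := by
      have : (R : ℝ) ≤ 2 := by exact_mod_cast hR2
      linarith
    have hup : up x₀ μ ∈ univ.filter (fun x : UT N => dist x x₀ ≤ 2 * R + 2) := by
      refine Finset.mem_filter.mpr ⟨Finset.mem_univ _, ?_⟩
      have h1 := dist_up_le x₀ μ
      rw [dist_comm] at h1
      have : (0 : ℝ) ≤ R := Nat.cast_nonneg R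
      linarith
    have htriv : |w (up x₀ μ) - w x₀| ≤ 2 * M := by
      calc |w (up x₀ μ) - w x₀| ≤ |w (up x₀ μ)| + |w x₀| := abs_sub _ _
        _ ≤ M + M := add_le_add (hM _ hup) (hM _ hx₀)
        _ = 2 * M := by ring
    have hK6 := Kgrad_four_ge
    have hfirst : 2 * M ≤ Kgrad 4 * M / ((R : ℝ) + 1) := by
      rw [le_div_iff₀ hR0]
      nlinarith
    linarith

end

end Summit.QuantumFields.BalabanUV.Beta.FlatGradientBinderD4
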